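import Mathlib
import HarnessLib
import Literature.Analysis.FluidPDE.VectorCalculus
import Literature.Analysis.FluidPDE.VorticityCalculus
import Summits.NavierStokesRegularity.NavierStokesRegularity.Theorems.UnthreadedDoorAntidynamoReflectionParity
import Summits.NavierStokesRegularity.NavierStokesRegularity.Theorems.UnthreadedDoorCellFluxZonalVorticityVanishes
import Summits.NavierStokesRegularity.NavierStokesRegularity.Theorems.UnthreadedDoorToroidalPotential
import Summits.NavierStokesRegularity.NavierStokesRegularity.Theorems.UnthreadedDoorVorticityOfClass
import Summits.NavierStokesRegularity.NavierStokesRegularity.Theorems.UnthreadedDoorConstantOfIrrotational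

/-!
# Route `UnthreadedDoor` / `ThreadingFlux`, crux `PoloidalLiouville` (stmt-NavierStokesRegularity-1222), antidynamo v2 skeleton
# (sha16 `4ebf5683127b`): THE WALL `stub_scalarLiouville` ON THE EVEN SECTOR WITH A NON-STAGNANT CENTRE

Support file (seat leafhand-ns-unthreadeddoor-2 g0, cell decomp-ns), `--supports stmt-NavierStokesRegularity-1222 --as helper`; theorems only.

THE POINT.  The odd sector of the wall is a tree theorem (`stubScalarLiouville_of_odd_potential`, p799093: odd potential ⇒ odd
vorticity ⇒ caloric ⇒ zero).  On the EVEN sector (potential `T(t, ·)` even under the point reflection `w ↦ x₀ + x₀ − w`, equivalently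
EVEN vorticity about `x₀`; it contains every zonal = axisymmetric-no-swirl potential and every even single-degree mode) the parity splitting
of the vorticity equation leaves exactly one identity, `Dω(t, x)[2 v(t, x₀)] = 0` (`fderiv_vorticity_apply_eq_zero_of_curl_even`, p798954).
Differentiating the unthreadedness identity `⟪x − x₀, ω(t, x)⟫ ≡ 0` along the centre velocity `k = 2 v(t, x₀)` turns it into a POINTWISE
ORTHOGONALITY: `⟪ω(t, x), k⟫ = −⟪Dω(t, x) k, x − x₀⟫ = 0`.  Hence

* ★ `inner_centreVelocity_curl_eq_zero_of_curl_even` — **for an unthreaded bounded ancient mild solution (duality class, measurable slices,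
  jointly smooth) with EVEN vorticity about the centre, the vorticity is at every time orthogonal to the centre velocity:
  `⟪v(t, x₀), curl v(t, x)⟫ = 0` for all `t < 0`, `x`** (general potentials — no single-degree structure);
* ★★ `curl_eq_zero_of_curl_even_of_centre_ne_zero` / `constant_of_curl_even_of_centre_ne_zero` — if moreover the centre NEVER
  STAGNATES, `v(t, x₀) ≠ 0` for all `t < 0`, then `v(t, x₀)` is a direction orthogonal to the vorticity at every time, and the tree's
  cell-flux theorem Z `CellFlux.zonalUnthreadedVorticityVanishes` («KNSS 2009 Thm 5.2 in a moving frame», PROVED) gives `curl v ≡ 0`, so the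
  slices are constant (`constantOfIrrotational`);
* ★★ `stubScalarLiouville_of_even_potential_of_centre_ne_zero` — the same in the LETTER of the registered wall `StubScalarLiouville`
  (class, measurability, joint smoothness, the representation `curl v = ∇T × (x − x₀)`; the evolution law (E1), the bound and the
  smoothness of `T` are not needed): `T(t, ·)` even about `x₀` and `v(t, x₀) ≠ 0` for all `t < 0` ⇒ `∇T × (x − x₀) ≡ 0`;
* `inner_centreVelocity_cross_gradient_eq_zero_of_even_potential` — the unconditional residue on the whole even sector:
  `⟪v(t, x₀), ∇T(t, x) × (x − x₀)⟫ = 0`.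

WHAT REMAINS OF THE WALL after the odd sector (p799093) and this file: (i) even potentials whose centre STAGNATES at some time
(`∃ t < 0, v(t, x₀) = 0`; for the even single-degree rung this is the (E1) assembly of the census, `stub_singleDegreeRung`), and
(ii) potentials of mixed parity.  Compare the census's per-slice stagnation alternative for single-degree modes
(`evenRung_slice_const_of_centre_velocity_ne_zero`, p812603, translation rigidity): here the potential is ARBITRARY even, the price being
the all-time hypothesis that Z (a dynamic theorem on the ancient interval) consumes.

HONEST LABEL: a sector of the wall; nothing here proves `stub_scalarLiouville`, `PoloidalLiouville` (1222), or bears on Navier–Stokes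
regularity; no summit statement is proved (crux 1222 is INCOMPARABLE with the summit). [folklore]
[cite: KochNadirashviliSereginSverak2009, Thm 5.2 (arXiv:0709.3599 pp. 9–10)]
-/

noncomputable section

-- the summit and its single sub-problem share the name (CONVENTIONS §1)
set_option linter.dupNamespace false

open scoped Topology InnerProductSpace RealInnerProductSpace ContDiff
open Filter Set Function Metric MeasureTheory
open Literature.Analysis.FluidPDE

namespace Summit.NavierStokesRegularity.NavierStokesRegularity.Theorems.PoloidalLiouville.Antidynamo

open Summit.NavierStokesRegularity.NavierStokesRegularity.Theorems.PoloidalLiouville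
  (toroidalPotential exists_norm_curl_le constantOfIrrotational vorticityOfClass)

/-! ### Pointwise kinematics -/

/-- **Unthreaded + translation-flat along `k` ⇒ orthogonal to `k`.**  If a `C²` field `V` has vorticity tangent to the spheres about `x₀`,
`⟪x − x₀, curl V x⟫ = 0` for all `x`, and the vorticity has vanishing derivative along a fixed vector `k` everywhere, `D(curl V)(x) k = 0`,
then `⟪k, curl V x⟫ = 0` for all `x` (differentiate the tangency identity along `k`). [folklore] -/
theorem inner_curl_eq_zero_of_fderiv_curl_apply_eq_zero
    {V : EuclideanSpace ℝ (Fin 3) → EuclideanSpace ℝ (Fin 3)} (hV : ContDiff ℝ 2 V) (x₀ k : EuclideanSpace ℝ (Fin 3))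
    (hun : ∀ x, ⟪x - x₀, curl V x⟫ = 0) (hD : ∀ x, fderiv ℝ (curl V) x k = 0) (x : EuclideanSpace ℝ (Fin 3)) :
    ⟪k, curl V x⟫ = 0 := by
  have hω : ContDiff ℝ 1 (curl V) := contDiff_curl (n := 1) (hV.of_le (by norm_num))
  have hωd : DifferentiableAt ℝ (curl V) x := (hω.differentiable one_ne_zero) x
  have hid : DifferentiableAt ℝ (fun y : EuclideanSpace ℝ (Fin 3) => y - x₀) x := differentiableAt_id.sub_const x₀
  have hconst : (fun y : EuclideanSpace ℝ (Fin 3) => ⟪y - x₀, curl V y⟫) = fun _ => (0 : ℝ) := funext hun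
  have h0 : fderiv ℝ (fun y : EuclideanSpace ℝ (Fin 3) => ⟪y - x₀, curl V y⟫) x k = 0 := by
    rw [hconst]
    simp
  rw [fderiv_inner_apply ℝ hid hωd k, hD x, inner_zero_right, zero_add, fderiv_sub_const, fderiv_fun_id,
    ContinuousLinearMap.coe_id', id_eq] at h0
  exact h0

/-! ### ★ Even vorticity: the vorticity is orthogonal to the centre velocity -/

/-- ★ **EVEN UNTHREADED VORTICITY IS ORTHOGONAL TO THE CENTRE VELOCITY.**  Let `v` be a bounded ancient mild solution (`ν = 1`, duality
class) with measurable slices, jointly smooth on `(−∞,0) × ℝ³`, unthreaded about `x₀` (`⟪x − x₀, curl v(t, x)⟫ = 0`) and with vorticity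
EVEN under the point reflection about `x₀` (`curl v(t)(x₀ + x₀ − x) = curl v(t)(x)`) at every `t < 0`.  Then
`⟪v(t, x₀), curl v(t, x)⟫ = 0` for all `t < 0` and `x`.  [Even curl ⇒ velocity odd up to `k(t) = 2 v(t, x₀)` (`reflect_eq_of_curl_even`);
parity splitting of the vorticity equation (bridge `vorticityOfClass`) ⇒ `Dω(t, x) k(t) = 0` (`fderiv_vorticity_apply_eq_zero_of_curl_even`);
then `inner_curl_eq_zero_of_fderiv_curl_apply_eq_zero`.] [folklore] -/
theorem inner_centreVelocity_curl_eq_zero_of_curl_even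
    (v : ℝ → EuclideanSpace ℝ (Fin 3) → EuclideanSpace ℝ (Fin 3)) (x₀ : EuclideanSpace ℝ (Fin 3))
    (hB : Literature.Analysis.FluidPDE.IsBoundedAncientMildSolution 1 v)
    (hm : ∀ t < 0, AEStronglyMeasurable (v t) volume)
    (hsm : ContDiffOn ℝ (⊤ : ℕ∞) (Function.uncurry v) (Set.Iio 0 ×ˢ Set.univ))
    (hun : ∀ t < 0, ∀ x, ⟪x - x₀, curl (v t) x⟫ = 0)
    (hev : ∀ t < 0, ∀ x, curl (v t) (x₀ + x₀ - x) = curl (v t) x) :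
    ∀ t < 0, ∀ x, ⟪v t x₀, curl (v t) x⟫ = 0 := by
  have hsm' : IsSmoothSpaceTimeOn (Iio 0) v := hsm
  obtain ⟨M, hM⟩ := hB.isBoundedOn
  obtain ⟨hV, -⟩ := vorticityOfClass v hB hm hsm
  -- the velocity is odd up to the constant `k s = 2 v(s, x₀)`
  set k : ℝ → EuclideanSpace ℝ (Fin 3) := fun s => v s x₀ + v s x₀ with hk
  have hrefl : ∀ s < 0, ∀ y, v s (x₀ + x₀ - y) = k s - v s y := by
    intro s hs y
    have hvs : ContDiff ℝ ∞ (v s) := hsm'.contDiff_slice hs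
    have hv2 : ContDiff ℝ 2 (v s) := hvs.of_le (by norm_cast)
    have hv1 : ContDiff ℝ 1 (v s) := hvs.of_le (by norm_cast)
    have hdiv : VectorCalculus.IsDivFree (v s) := (hB.isAncientMildSolution.1 s hs).isDivFree_of_contDiff hv1
    have h := reflect_eq_of_curl_even hv2 hdiv (fun y => hM s hs y) (x₀ + x₀) (hev s hs) y x₀
    rw [add_sub_cancel_right] at h
    rw [hk]
    exact eq_sub_of_add_eq h
  intro t ht x
  have hvt : ContDiff ℝ ∞ (v t) := hsm'.contDiff_slice ht
  have hv2 : ContDiff ℝ 2 (v t) := hvt.of_le (by norm_cast)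
  have hD : ∀ y, fderiv ℝ (curl (v t)) y (k t) = 0 := fun y => by
    have h := fderiv_vorticity_apply_eq_zero_of_curl_even hV (x₀ + x₀) k hrefl hev ht y
    rwa [vorticity_apply] at h
  have h2 : ⟪k t, curl (v t) x⟫ = 0 := inner_curl_eq_zero_of_fderiv_curl_apply_eq_zero hv2 x₀ (k t) (hun t ht) hD x
  have h3 : ⟪k t, curl (v t) x⟫ = 2 * ⟪v t x₀, curl (v t) x⟫ := by
    rw [hk, inner_add_left, two_mul]
  rw [h3] at h2
  exact (mul_eq_zero.1 h2).resolve_left two_ne_zero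

/-! ### ★★ The even sector with a non-stagnant centre is irrotational -/

/-- ★★ **EVEN VORTICITY + NON-STAGNANT CENTRE ⇒ IRROTATIONAL.**  Under the hypotheses of `inner_centreVelocity_curl_eq_zero_of_curl_even`,
if the centre never stagnates, `v(t, x₀) ≠ 0` for every `t < 0`, then `curl v ≡ 0` on `(−∞,0) × ℝ³`: the centre velocity is at every time
a non-zero direction orthogonal to the vorticity, the toroidal potential exists (`toroidalPotential`, bounded curl `exists_norm_curl_le`), and
the cell-flux theorem Z `CellFlux.zonalUnthreadedVorticityVanishes` (KNSS Thm 5.2 in a moving frame, PROVED in the tree) concludes.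
[cite: KochNadirashviliSereginSverak2009, Thm 5.2 (arXiv:0709.3599 pp. 9–10)] -/
theorem curl_eq_zero_of_curl_even_of_centre_ne_zero
    (v : ℝ → EuclideanSpace ℝ (Fin 3) → EuclideanSpace ℝ (Fin 3)) (x₀ : EuclideanSpace ℝ (Fin 3))
    (hB : Literature.Analysis.FluidPDE.IsBoundedAncientMildSolution 1 v)
    (hm : ∀ t < 0, AEStronglyMeasurable (v t) volume)
    (hsm : ContDiffOn ℝ (⊤ : ℕ∞) (Function.uncurry v) (Set.Iio 0 ×ˢ Set.univ))
    (hun : ∀ t < 0, ∀ x, ⟪x - x₀, curl (v t) x⟫ = 0)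
    (hev : ∀ t < 0, ∀ x, curl (v t) (x₀ + x₀ - x) = curl (v t) x)
    (hne : ∀ t < 0, v t x₀ ≠ 0) :
    ∀ t < 0, ∀ x, curl (v t) x = 0 := by
  obtain ⟨K, hK⟩ := exists_norm_curl_le hB hsm
  obtain ⟨T, -, -, hlink⟩ := toroidalPotential v x₀ K hsm hK hun
  exact CellFlux.zonalUnthreadedVorticityVanishes v x₀ T hB hm hsm hlink fun t ht =>
    ⟨v t x₀, hne t ht, inner_centreVelocity_curl_eq_zero_of_curl_even v x₀ hB hm hsm hun hev t ht⟩

/-- ★★ **… HENCE SLICE-WISE CONSTANT** (`constantOfIrrotational`). [cite: KochNadirashviliSereginSverak2009, Thm 5.2 (arXiv:0709.3599 pp. 9–10)] -/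
theorem constant_of_curl_even_of_centre_ne_zero
    (v : ℝ → EuclideanSpace ℝ (Fin 3) → EuclideanSpace ℝ (Fin 3)) (x₀ : EuclideanSpace ℝ (Fin 3))
    (hB : Literature.Analysis.FluidPDE.IsBoundedAncientMildSolution 1 v)
    (hm : ∀ t < 0, AEStronglyMeasurable (v t) volume)
    (hsm : ContDiffOn ℝ (⊤ : ℕ∞) (Function.uncurry v) (Set.Iio 0 ×ˢ Set.univ))
    (hun : ∀ t < 0, ∀ x, ⟪x - x₀, curl (v t) x⟫ = 0)
    (hev : ∀ t < 0, ∀ x, curl (v t) (x₀ + x₀ - x) = curl (v t) x)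
    (hne : ∀ t < 0, v t x₀ ≠ 0) :
    ∀ t < 0, ∃ b : EuclideanSpace ℝ (Fin 3), ∀ x, v t x = b :=
  constantOfIrrotational v hB hsm (curl_eq_zero_of_curl_even_of_centre_ne_zero v x₀ hB hm hsm hun hev hne)

/-! ### ★★ The wall's letter: even potentials -/

/-- The gradient of a function that is EVEN under `w ↦ c − w` is ODD under it (junk values included: `D(f(c − ·)) = −Df(c − ·)` holds
unconditionally). [folklore] -/
theorem gradient_reflect_of_even {T : EuclideanSpace ℝ (Fin 3) → ℝ} (c : EuclideanSpace ℝ (Fin 3))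
    (heven : ∀ x, T (c - x) = T x) (x : EuclideanSpace ℝ (Fin 3)) :
    gradient T (c - x) = -gradient T x := by
  have hfun : (fun w => T (c - w)) = T := funext heven
  have h := fderiv_comp_const_sub T c x
  rw [hfun] at h
  have h2 : fderiv ℝ T (c - x) = -fderiv ℝ T x := by rw [h, neg_neg]
  rw [gradient, gradient, h2, map_neg]

/-- An EVEN toroidal potential gives an EVEN toroidal field: `∇T × (· − x₀)` is even about `x₀` when `T` is. [folklore] -/
theorem curl_reflect_of_even_potential {V : EuclideanSpace ℝ (Fin 3) → EuclideanSpace ℝ (Fin 3)}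
    {T : EuclideanSpace ℝ (Fin 3) → ℝ} {x₀ : EuclideanSpace ℝ (Fin 3)}
    (hrep : ∀ x, curl V x = cross (gradient T x) (x - x₀)) (heven : ∀ x, T (x₀ + x₀ - x) = T x)
    (x : EuclideanSpace ℝ (Fin 3)) : curl V (x₀ + x₀ - x) = curl V x := by
  rw [hrep, hrep, gradient_reflect_of_even (x₀ + x₀) heven x]
  have e1 : x₀ + x₀ - x - x₀ = -(x - x₀) := by abel
  rw [e1, ← crossCLM_apply, ← crossCLM_apply, map_neg, map_neg, _root_.neg_apply, neg_neg]

/-- **On the whole even sector the toroidal field is orthogonal to the centre velocity** (the wall's letter; no non-stagnation assumed):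
`⟪v(t, x₀), ∇T(t, x) × (x − x₀)⟫ = 0` for all `t < 0`, `x`. [folklore] -/
theorem inner_centreVelocity_cross_gradient_eq_zero_of_even_potential
    (v : ℝ → EuclideanSpace ℝ (Fin 3) → EuclideanSpace ℝ (Fin 3)) (x₀ : EuclideanSpace ℝ (Fin 3))
    (T : ℝ → EuclideanSpace ℝ (Fin 3) → ℝ)
    (hB : Literature.Analysis.FluidPDE.IsBoundedAncientMildSolution 1 v)
    (hm : ∀ t < 0, AEStronglyMeasurable (v t) volume)
    (hsm : ContDiffOn ℝ (⊤ : ℕ∞) (Function.uncurry v) (Set.Iio 0 ×ˢ Set.univ))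
    (hrep : ∀ t < 0, ∀ x, Literature.Analysis.FluidPDE.curl (v t) x =
      Literature.Analysis.FluidPDE.cross (gradient (T t) x) (x - x₀))
    (hTeven : ∀ t < 0, ∀ x, T t (x₀ + x₀ - x) = T t x) :
    ∀ t < 0, ∀ x, ⟪v t x₀, Literature.Analysis.FluidPDE.cross (gradient (T t) x) (x - x₀)⟫ = 0 := by
  -- a toroidal field is tangent to the spheres: `⟪y, a × y⟫ = 0`
  have hun : ∀ t < 0, ∀ x, ⟪x - x₀, curl (v t) x⟫ = 0 := fun t ht x => by
    rw [hrep t ht x]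
    simp [cross, crossProduct, PiLp.inner_apply, Fin.sum_univ_three]
    ring
  have hev : ∀ t < 0, ∀ x, curl (v t) (x₀ + x₀ - x) = curl (v t) x := fun t ht =>
    curl_reflect_of_even_potential (hrep t ht) (hTeven t ht)
  intro t ht x
  rw [← hrep t ht x]
  exact inner_centreVelocity_curl_eq_zero_of_curl_even v x₀ hB hm hsm hun hev t ht x

/-- ★★ **THE WALL ON THE EVEN SECTOR WITH A NON-STAGNANT CENTRE.**  Let `v` be a bounded ancient mild solution (`ν = 1`, duality class)
with measurable slices, jointly smooth on `(−∞,0) × ℝ³`, whose vorticity is represented by a toroidal potential,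
`curl (v t) x = ∇T(t, x) × (x − x₀)`, with `T(t, ·)` EVEN under the point reflection about `x₀` for every `t < 0`, and suppose the centre
never stagnates: `v(t, x₀) ≠ 0` for all `t < 0`.  Then `∇T(t, x) × (x − x₀) = 0` for all `t < 0`, `x` — the conclusion of the registered
wall `StubScalarLiouville`, on this sector and without its remaining hypotheses ((E1), the bound and the smoothness of `T`).
[cite: KochNadirashviliSereginSverak2009, Thm 5.2 (arXiv:0709.3599 pp. 9–10)] -/
theorem stubScalarLiouville_of_even_potential_of_centre_ne_zero
    (v : ℝ → EuclideanSpace ℝ (Fin 3) → EuclideanSpace ℝ (Fin 3)) (x₀ : EuclideanSpace ℝ (Fin 3))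
    (T : ℝ → EuclideanSpace ℝ (Fin 3) → ℝ)
    (hB : Literature.Analysis.FluidPDE.IsBoundedAncientMildSolution 1 v)
    (hm : ∀ t < 0, AEStronglyMeasurable (v t) volume)
    (hsm : ContDiffOn ℝ (⊤ : ℕ∞) (Function.uncurry v) (Set.Iio 0 ×ˢ Set.univ))
    (hrep : ∀ t < 0, ∀ x, Literature.Analysis.FluidPDE.curl (v t) x =
      Literature.Analysis.FluidPDE.cross (gradient (T t) x) (x - x₀))
    (hTeven : ∀ t < 0, ∀ x, T t (x₀ + x₀ - x) = T t x)
    (hne : ∀ t < 0, v t x₀ ≠ 0) :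
    ∀ t < 0, ∀ x, Literature.Analysis.FluidPDE.cross (gradient (T t) x) (x - x₀) = 0 := by
  have h0 := CellFlux.zonalUnthreadedVorticityVanishes v x₀ T hB hm hsm hrep fun t ht =>
    ⟨v t x₀, hne t ht, fun x => by
      rw [hrep t ht x]
      exact inner_centreVelocity_cross_gradient_eq_zero_of_even_potential v x₀ T hB hm hsm hrep hTeven t ht x⟩
  intro t ht x
  rw [← hrep t ht x]
  exact h0 t ht x

end Summit.NavierStokesRegularity.NavierStokesRegularity.Theorems.PoloidalLiouville.Antidynamo

end
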